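import Summits.PneNP.PneNP.Theses.ExpanderLinearGenerators

/-!
# PneNP / ExpanderLinearGenerators — glue `ExpansionGivesLinearGeneratorHard` (stmt-PneNP-11446)

Route `PneNP/ExpanderLinearGenerators`, support item stmt-PneNP-11446:

  `ExpansionForcesDepthFregeSize → LinearGeneratorDepthFregeHard`

(crux 2 ⇒ crux 3 of the route). The expansion-scale law gives, for each locality `ℓ ≥ 1` and depth
`d`, an exponent `ε > 0` and a threshold `R` such that every `ℓ`-sparse unsolvable system over `F₂`
whose row supports form an `(r, 3/4·ℓ)`-boundary expander with `r ≥ R` forces depth-`d`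
textbook-Frege proofs of `¬ sumEncoding 1 E` to have size `≥ 2^(r^ε)`. Krajíček's linear-generator
statement (Problem 19.4.5 form) asks the same for the expansion scale `r := n^(1-δ)` with a bound
`2^(n^ε')` for `n ≥ N`. This is pure parameter bookkeeping:

* `ε' := (1 - δ) · ε > 0` (as `δ < 1`);
* `N` is any natural number with `R ≤ n^(1-δ)` for all `n ≥ N`, which exists because
  `n ↦ (n : ℝ)^(1-δ)` tends to `+∞` (`tendsto_rpow_atTop`, `1 - δ > 0`);
* `(n^(1-δ))^ε = n^((1-δ)·ε)` by `Real.rpow_mul` (`0 ≤ (n : ℝ)`).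

Source of the statement: J. Krajíček, *Proof Complexity* (CUP 2019), Problem 19.4.5 and
Cor. 13.4.6 (the instantiation `r := n^(1-δ)` of the expander parameter). No new definitions.
-/

namespace Summit.PneNP.PneNP.Theorems

open Filter

/-- **Glue crux 2 → crux 3 of route ExpanderLinearGenerators** (item stmt-PneNP-11446):
`ExpansionForcesDepthFregeSize → LinearGeneratorDepthFregeHard`. Given `ℓ ≥ 1`, `0 < δ < 1` and a
depth `d`, take `ε, R` from the expansion-scale law for `(ℓ, d)`; put `ε' := (1-δ)·ε` and choose
`N` with `R ≤ n^(1-δ)` for all `n ≥ N` (the map `n ↦ n^(1-δ)` tends to infinity). For `n ≥ N` the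
law applies at expansion scale `r := n^(1-δ)`, and `2^((n^(1-δ))^ε) = 2^(n^((1-δ)·ε))` by
`Real.rpow_mul`. [KrajicekProofComplexity2019, Problem 19.4.5 / Cor. 13.4.6 for the choice
`r := n^(1-δ)`] -/
theorem expanderLinearGenerators_expansionGivesLinearGeneratorHard_proof :
    Summit.PneNP.PneNP.Theses.ExpanderLinearGenerators.ExpansionGivesLinearGeneratorHard := by
  unfold Summit.PneNP.PneNP.Theses.ExpanderLinearGenerators.ExpansionGivesLinearGeneratorHard
    Summit.PneNP.PneNP.Theses.ExpanderLinearGenerators.ExpansionForcesDepthFregeSize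
    Summit.PneNP.PneNP.Theses.ExpanderLinearGenerators.LinearGeneratorDepthFregeHard
  intro hLaw ℓ d δ hℓ hδ0 hδ1
  obtain ⟨ε, hε, R, hR⟩ := hLaw ℓ d hℓ
  have h1δ : 0 < 1 - δ := sub_pos.mpr hδ1
  -- the expansion scale `n ^ (1 - δ)` eventually exceeds the threshold `R`
  have hT : Tendsto (fun n : ℕ => ((n : ℝ)) ^ (1 - δ)) atTop atTop :=
    (tendsto_rpow_atTop h1δ).comp tendsto_natCast_atTop_atTop
  obtain ⟨N, hN⟩ := eventually_atTop.1 (hT.eventually_ge_atTop R)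
  refine ⟨(1 - δ) * ε, mul_pos h1δ hε, N, ?_⟩
  intro n hn m E hsparse hexp hunsat π hπ
  have hmain := hR ((n : ℝ) ^ (1 - δ)) (hN n hn) n m E hsparse hexp hunsat π hπ
  -- `(n ^ (1 - δ)) ^ ε = n ^ ((1 - δ) * ε)`
  rwa [← Real.rpow_mul (Nat.cast_nonneg n)] at hmain

end Summit.PneNP.PneNP.Theorems
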